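import Literature.AlgebraicGeometry.Motives.ProjectiveSpaceLinearMapsPoints
import Mathlib.RingTheory.MvPolynomial.Ideal
import HarnessLib

/-!
# Linear maps `ℙʳ_k → ℙᴺ_k` from linear forms whose span contains the variables

`Motives/ProjectiveSpaceLinearMaps` constructs the linear map `linSubstMap τ : ℙʳ_k ⟶ ℙᴺ_k`,
`[y] ↦ [τ₀(y) : ⋯ : τ_N(y)]`, of a substitution `xᵢ ↦ τᵢ(y)` by linear forms under the hypothesis that
every variable `y_j` IS one of the forms `τᵢ` (echelon form). This file records the same construction
(same graded homomorphism `ProjectiveSpace.linSubstGraded`, Mathlib `Proj.map`, same proofs) under the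
natural weaker hypothesis that every variable `y_j` lies in the IDEAL `(τ₀, …, τ_N)` — i.e. the
`(N+1) × (r+1)` coefficient matrix has rank `r + 1`, the forms have no common zero — which is the form
in which linear maps arise in practice, e.g. the line `[w₀ : w₁] ↦ [w₁ a₀ − w₀ a₁]` of a pencil of
hyperplanes in the dual projective space (Voisin, *Hodge Theory II*, §2.1.1):

* `irrelevant_le_map_linSubstGraded_of_mem_span` — the hypothesis of `Proj.map` (a homogeneous element
  of positive degree lies in the ideal of the variables, Mathlib `MvPolynomial.mem_ideal_span_X_image`);
* `linSpanMapHom`, `linSpanMap` — the morphism `ℙʳ_k ⟶ ℙᴺ_k`, over `k` (`linSpanMapHom_comp_projToSpec`);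
* `pointOfVec_comp_linSpanMap` — **`[y] ↦ [τ(y)]` on `L`-points** (Hartshorne II Ex. 2.14, II Thm. 7.1;
  for `τ(y) ≠ 0`, which holds for every `y ≠ 0` under the hypothesis, cf.
  `ProjectiveSpace.linSubstVec_ne_zero` in the echelon case).

## References

* R. Hartshorne, *Algebraic Geometry*, GTM 52 (1977): II Ex. 2.14, II Thm. 7.1. [Hartshorne1977]
* C. Voisin, *Hodge Theory and Complex Algebraic Geometry II*, CUP 2003, §2.1.1. [VoisinHodgeII2003]
-/

noncomputable section

open CategoryTheory AlgebraicGeometry HomogeneousLocalization MvPolynomial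

universe u

namespace Literature.AlgebraicGeometry.Motives

namespace ProjectiveSpace

variable {k : Type u} [Field k] {N r : ℕ}

attribute [local instance] MvPolynomial.gradedAlgebra ProjBaseChange.algebraBase

/-! ### The irrelevant ideal is generated when the variables lie in the ideal of the forms -/

section Span

variable (τ : Fin (N + 1) → MvPolynomial (Fin (r + 1)) k) (hτ : ∀ i, (τ i).IsHomogeneous 1)
  (hgen : ∀ j : Fin (r + 1), (X j : MvPolynomial (Fin (r + 1)) k) ∈ Ideal.span (Set.range τ))

include hgen in
open HomogeneousIdeal in
/-- **Forms whose ideal contains the variables generate the irrelevant ideal**: if every `y_j` lies in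
`(τ₀, …, τ_N)` then `k[y]₊ ≤ σ_τ(k[x]₊)·k[y]` (the hypothesis of Mathlib's `Proj.map`): a homogeneous
element of positive degree lies in the ideal of the variables (`MvPolynomial.mem_ideal_span_X_image`),
and `τᵢ = σ_τ xᵢ` with `xᵢ ∈ k[x]₊`. [folklore] -/
theorem irrelevant_le_map_linSubstGraded_of_mem_span :
    HomogeneousIdeal.irrelevant (MvPolynomial.homogeneousSubmodule (Fin (r + 1)) k) ≤
      (HomogeneousIdeal.irrelevant (MvPolynomial.homogeneousSubmodule (Fin (N + 1)) k)).map
        (linSubstGraded τ hτ) := by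
  rw [← toIdeal_le_toIdeal_iff, irrelevant_eq_span, Ideal.span_le, toIdeal_map]
  -- the ideal generated by the `τᵢ = σ_τ xᵢ` lies in the image of the irrelevant ideal
  have hτmem : Ideal.span (Set.range τ) ≤
      Ideal.map (linSubstGraded τ hτ)
        (HomogeneousIdeal.irrelevant (MvPolynomial.homogeneousSubmodule (Fin (N + 1)) k)).toIdeal := by
    rw [Ideal.span_le]
    rintro _ ⟨i, rfl⟩
    have hi : τ i = linSubstGraded τ hτ (X i) := by rw [linSubstGraded_apply, aeval_X]
    rw [SetLike.mem_coe, hi]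
    exact Ideal.mem_map_of_mem _ (mem_irrelevant_of_mem _ one_pos (X_mem i))
  -- hence so does the ideal of the variables
  have hX : Ideal.span (MvPolynomial.X '' (Set.univ : Set (Fin (r + 1))) : Set (MvPolynomial (Fin (r + 1)) k)) ≤
      Ideal.map (linSubstGraded τ hτ)
        (HomogeneousIdeal.irrelevant (MvPolynomial.homogeneousSubmodule (Fin (N + 1)) k)).toIdeal := by
    rw [Ideal.span_le]
    rintro _ ⟨j, -, rfl⟩
    exact hτmem (hgen j)
  intro x hx
  simp only [Set.mem_iUnion, SetLike.mem_coe, exists_prop] at hx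
  obtain ⟨i, hi, hx⟩ := hx
  refine hX (MvPolynomial.mem_ideal_span_X_image.mpr fun d hd ↦ ?_)
  -- a monomial of positive degree involves some variable
  have hdeg : Finsupp.weight (1 : Fin (r + 1) → ℕ) d = i :=
    (mem_homogeneousSubmodule i x).mp hx (mem_support_iff.mp hd)
  by_contra hnone
  push Not at hnone
  have hd0 : d = 0 := by
    ext l
    exact hnone l (Set.mem_univ l)
  rw [hd0, map_zero] at hdeg
  omega

/-- **The linear map of projective spaces `ℙʳ_k → ℙᴺ_k`, `[y] ↦ [τ₀(y) : ⋯ : τ_N(y)]`, of linear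
forms whose ideal contains the variables**, as a morphism of schemes (Mathlib `Proj.map` of
`linSubstGraded τ`). [cite: Hartshorne1977, II Thm. 7.1] -/
def linSpanMapHom :
    Proj (MvPolynomial.homogeneousSubmodule (Fin (r + 1)) k) ⟶ Proj (MvPolynomial.homogeneousSubmodule (Fin (N + 1)) k) :=
  Proj.map (linSubstGraded τ hτ) (irrelevant_le_map_linSubstGraded_of_mem_span τ hτ hgen)

/-- `linSpanMapHom` is Mathlib's `Proj.map` (`rfl`). [folklore] -/
theorem linSpanMapHom_eq :
    linSpanMapHom τ hτ hgen =
      Proj.map (linSubstGraded τ hτ) (irrelevant_le_map_linSubstGraded_of_mem_span τ hτ hgen) :=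
  rfl

/-- On the chart `D₊(σ_τ s) → D₊(s)` the map is `Spec (Away.map σ_τ s)`, a morphism over `Spec k`
(Mathlib `Proj.awayι_comp_map`). [folklore] -/
theorem awayι_comp_linSpanMapHom_comp_projToSpec {i : ℕ} (hi : 0 < i)
    (s : MvPolynomial (Fin (N + 1)) k) (hs : s ∈ MvPolynomial.homogeneousSubmodule (Fin (N + 1)) k i) :
    Proj.awayι (MvPolynomial.homogeneousSubmodule (Fin (r + 1)) k) (linSubstGraded τ hτ s)
        ((linSubstGraded τ hτ).map_mem hs) hi ≫ linSpanMapHom τ hτ hgen ≫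
        ProjBaseChangeRing.projToSpec (Fin (N + 1)) k =
      Proj.awayι (MvPolynomial.homogeneousSubmodule (Fin (r + 1)) k) (linSubstGraded τ hτ s)
        ((linSubstGraded τ hτ).map_mem hs) hi ≫ ProjBaseChangeRing.projToSpec (Fin (r + 1)) k := by
  -- adapted from `ProjectiveSpace.awayι_comp_linSubstMapHom_comp_projToSpec`
  rw [linSpanMapHom_eq, Proj.awayι_comp_map_assoc _ _ hi s hs, ProjBaseChangeRing.awayι_projToSpec,
    ProjBaseChangeRing.awayι_projToSpec, ← Spec.map_comp, ← CommRingCat.ofHom_comp]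
  congr 2
  exact RingHom.ext fun c ↦ awayMap_linSubstGraded_algebraMap τ hτ s c

/-- **`linSpanMapHom` is a morphism over `Spec k`** (checked on the open cover of the source by the
`D₊(σ_τ s)`, Mathlib `Proj.mapAffineOpenCover`). [folklore] -/
theorem linSpanMapHom_comp_projToSpec :
    linSpanMapHom τ hτ hgen ≫ ProjBaseChangeRing.projToSpec (Fin (N + 1)) k =
      ProjBaseChangeRing.projToSpec (Fin (r + 1)) k := by
  refine (Proj.mapAffineOpenCover (linSubstGraded τ hτ)
    (irrelevant_le_map_linSubstGraded_of_mem_span τ hτ hgen)).openCover.hom_ext _ _ fun s ↦ ?_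
  rw [Scheme.AffineOpenCover.openCover_f, Proj.mapAffineOpenCover_f]
  exact awayι_comp_linSpanMapHom_comp_projToSpec τ hτ hgen s.1.2 s.2 s.2.2

/-- **The linear map `ℙʳ_k ⟶ ℙᴺ_k` over `k`** attached to linear forms `τ₀, …, τ_N` in `r + 1`
variables whose ideal contains the variables. [cite: Hartshorne1977, II Thm. 7.1] -/
def linSpanMap : projectiveSpace r k ⟶ projectiveSpace N k :=
  Over.homMk (linSpanMapHom τ hτ hgen) (linSpanMapHom_comp_projToSpec τ hτ hgen)

/-- The underlying morphism of `linSpanMap` is `Proj.map σ_τ`. [folklore] -/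
@[simp]
theorem linSpanMap_left : (linSpanMap τ hτ hgen).left = linSpanMapHom τ hτ hgen := rfl

/-- `linSpanMap` pulls the basic open `D₊(s)` back to `D₊(σ_τ s)` (Mathlib `Proj.map_preimage_basicOpen`).
[folklore] -/
theorem linSpanMap_preimage_basicOpen (s : MvPolynomial (Fin (N + 1)) k) :
    (linSpanMap τ hτ hgen).left ⁻¹ᵁ Proj.basicOpen (MvPolynomial.homogeneousSubmodule (Fin (N + 1)) k) s =
      Proj.basicOpen (MvPolynomial.homogeneousSubmodule (Fin (r + 1)) k) (linSubstGraded τ hτ s) :=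
  rfl

end Span

/-! ### The action on field-valued points -/

section Points

variable {L : Type u} [Field L] [Algebra k L]
variable (τ : Fin (N + 1) → MvPolynomial (Fin (r + 1)) k) (hτ : ∀ i, (τ i).IsHomogeneous 1)
  (hgen : ∀ j : Fin (r + 1), (X j : MvPolynomial (Fin (r + 1)) k) ∈ Ideal.span (Set.range τ))

/-- **The linear map on points: `[y₀ : ⋯ : y_r] ↦ [τ₀(y) : ⋯ : τ_N(y)]`** (Hartshorne II Ex. 2.14:
the morphism of `Proj` induced by a graded homomorphism, read on `L`-points through the charts
`D₊(σ_τ xᵢ) → D₊(xᵢ)`, Mathlib `Proj.awayι_comp_map`). [cite: Hartshorne1977, II Ex. 2.14] -/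
theorem pointOfVec_comp_linSpanMap (y : Fin (r + 1) → L) (hy : y ≠ 0)
    (hτy : (fun i ↦ aeval y (τ i)) ≠ 0) :
    pointOfVec k y hy ≫ linSpanMap τ hτ hgen = pointOfVec k (fun i ↦ aeval y (τ i)) hτy := by
  -- adapted from `ProjectiveSpace.pointOfVec_comp_linSubstMap`
  obtain ⟨i, hi⟩ := Function.ne_iff.mp hτy
  have hi' : aeval (fun i ↦ aeval y (τ i)) (X i : MvPolynomial (Fin (N + 1)) k) ≠ 0 := aeval_X_ne_zero hi
  have hyi : aeval y (linSubstGraded τ hτ (X i : MvPolynomial (Fin (N + 1)) k)) ≠ 0 := by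
    rwa [aeval_linSubstGraded_eq]
  rw [pointOfVec_eq_chartPoint y hy ((linSubstGraded τ hτ).map_mem (X_mem i)) one_pos hyi,
    pointOfVec_eq_chartPoint _ hτy (X_mem i) one_pos hi']
  ext : 1
  rw [Over.comp_left, chartPoint_left, chartPoint_left, linSpanMap_left, linSpanMapHom_eq]
  change (Spec.map (CommRingCat.ofHom (awayEval y hyi).toRingHom) ≫
      Proj.awayι _ (linSubstGraded τ hτ (X i)) ((linSubstGraded τ hτ).map_mem (X_mem i)) one_pos) ≫
        Proj.map (linSubstGraded τ hτ) (irrelevant_le_map_linSubstGraded_of_mem_span τ hτ hgen) =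
    Spec.map (CommRingCat.ofHom (awayEval (fun i ↦ aeval y (τ i)) hi').toRingHom) ≫
      Proj.awayι _ (X i) (X_mem i) one_pos
  rw [Category.assoc, Proj.awayι_comp_map _ _ one_pos (X i) (X_mem i), ← Category.assoc,
    ← Spec.map_comp, ← CommRingCat.ofHom_comp,
    awayEval_comp_awayMap_linSubstGraded τ hτ y i hyi hi']

end Points

end ProjectiveSpace

end Literature.AlgebraicGeometry.Motives

end
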